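import Summits.QuantumFields.YangMills.Theorems.BalabanLadderIRLightCodeFrame
import HarnessLib

/-!
# Crux `BalabanLadder.IR` ∕ `IRcof` — LINE E «antipodal code»: the model-level CODE inequality (PROVED)

Ideator ym-ir-idea-14 gen 4.  HONESTY: finite-dimensional linear algebra only; nothing here proves the Clay Yang–Mills mass gap,
a lattice gap, `IRnsc`, `IRnscCof`, `IRcof` or `BalabanLadder.IR`.

In an honest light-frame transfer model (`T` positive, orthonormal frame `e` of exact eigenvectors with eigenvalues `θ_k ≥ 0`,
positive residual off the frame) the reflection-positive trace `tr(T^a A T^b A†)` dominates the θ-weighted Hilbert–Schmidt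
square of the frame block of `A` (`frame_sq_le_tr`); centring `A ↦ A − c·T^w` leaves `modelCorr` unchanged in either slot
(`modelCorr_sub_smul_pow_left/right`); hence the ANTIPODAL MIRROR VALUE `modelCorr T A A† S S w` controls the squared
Knill–Laflamme code defect of `A` with reference value the model mean (`code_defect_sq_le_antipodal`).  This is the heart of
LINE E's `stub_code`; what remains there is bookkeeping (per-level rate dichotomy, square roots, frame re-indexing).
-/

set_option autoImplicit false

noncomputable section

open scoped BigOperators InnerProductSpace
open InnerProductSpace
open Summit.QuantumFields.YangMills.Cruxes.IR.FluxCodeBlindness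
open Summit.QuantumFields.YangMills.Cruxes.IR.FluxCodeBlindness.CodeTrace

namespace Summit.QuantumFields.YangMills.Cruxes.IR.AntipodalCode

variable {E : Type*} [NormedAddCommGroup E] [InnerProductSpace ℝ E] [CompleteSpace E] [FiniteDimensional ℝ E] {q : ℕ}
  {T : E →L[ℝ] E} {e : Fin (q + 1) → E} {θ : Fin (q + 1) → ℝ} {ρ : ℝ}

local postfix:1024 "†" => ContinuousLinearMap.adjoint

/-! ## §1 Reflection positivity in a finite model -/

/-- `tr(R · M · Y · M†) ≥ 0` for positive `R`, `Y` (diagonalise `R`; each diagonal term is `λ_i ⟨M† b_i, Y M† b_i⟩ ≥ 0`). [folklore] -/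
theorem tr'_pos_mul_conj_nonneg {R Y : E →L[ℝ] E} (hR : R.IsPositive) (hY : Y.IsPositive) (M : E →L[ℝ] E) :
    0 ≤ tr' (R * M * Y * M†) := by
  have hsymm : (↑R : E →ₗ[ℝ] E).IsSymmetric := hR.isSymmetric
  have hn : Module.finrank ℝ E = Module.finrank ℝ E := rfl
  set b : OrthonormalBasis (Fin (Module.finrank ℝ E)) ℝ E := hsymm.eigenvectorBasis hn with hb
  set ev : Fin (Module.finrank ℝ E) → ℝ := hsymm.eigenvalues hn with hev
  have hev_nonneg : ∀ i, 0 ≤ ev i := fun i => hR.toLinearMap.nonneg_eigenvalues hn i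
  have hRb : ∀ i, R (b i) = ev i • b i := fun i => by
    have h := hsymm.apply_eigenvectorBasis hn i
    rw [ContinuousLinearMap.coe_coe] at h
    exact h
  unfold tr'
  rw [LinearMap.trace_eq_sum_inner _ b]
  refine Finset.sum_nonneg fun i _ => ?_
  have h1 : ⟪b i, (↑(R * M * Y * M†) : E →ₗ[ℝ] E) (b i)⟫_ℝ = ev i * ⟪Y (M† (b i)), M† (b i)⟫_ℝ := by
    rw [ContinuousLinearMap.coe_coe, mul_assoc, mul_assoc, mul_apply_eq_comp, ← hR.inner_left_eq_inner_right, hRb i,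
      real_inner_smul_left, mul_apply_eq_comp, mul_apply_eq_comp, ← ContinuousLinearMap.adjoint_inner_left, real_inner_comm]
  rw [h1]
  exact mul_nonneg (hev_nonneg i) (hY.inner_nonneg_left _)

omit [FiniteDimensional ℝ E] in
/-- Frame lower bound for the quadratic form of a transfer power: `⟨u, T^b u⟩ ≥ Σ_l θ_l^b ⟨e_l, u⟩²` (`T^b = P_b + R_b`, `R_b ≥ 0`). -/
theorem frame_sq_le_inner_pow (hon : Orthonormal ℝ e) (hT : T.IsPositive) (hTe : ∀ k, T (e k) = θ k • e k) (hρ : 0 ≤ ρ)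
    (hcon : ∀ v, (∀ k, ⟪e k, v⟫_ℝ = 0) → ‖T v‖ ≤ ρ * ‖v‖) (b : ℕ) (u : E) :
    ∑ l, θ l ^ b * ⟪e l, u⟫_ℝ ^ 2 ≤ ⟪u, (T ^ b) u⟫_ℝ := by
  have hsplit : ⟪u, (T ^ b) u⟫_ℝ = ⟪u, framePow e θ b u⟫_ℝ + ⟪u, resid T e θ b u⟫_ℝ := by
    rw [pow_eq_framePow_add_resid (e := e) (θ := θ) b, add_apply, inner_add_right]
  have hP : ⟪u, framePow e θ b u⟫_ℝ = ∑ l, θ l ^ b * ⟪e l, u⟫_ℝ ^ 2 := by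
    rw [framePow_apply, inner_sum]
    refine Finset.sum_congr rfl fun l _ => ?_
    rw [real_inner_smul_right, real_inner_comm]; ring
  have hR : 0 ≤ ⟪u, resid T e θ b u⟫_ℝ := by
    rw [real_inner_comm]
    exact (resid_isPositive hon hT hTe hρ hcon b).inner_nonneg_left u
  linarith

/-- **The Hilbert–Schmidt frame block is dominated by the reflection-positive trace**:
`Σ_{k,l} θ_k^a θ_l^b ⟨e_k, A e_l⟩² ≤ tr(T^a A T^b A†)`. -/
theorem frame_sq_le_tr (hon : Orthonormal ℝ e) (hT : T.IsPositive) (hTe : ∀ k, T (e k) = θ k • e k)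
    (hθ : ∀ k, 0 ≤ θ k) (hρ : 0 ≤ ρ) (hcon : ∀ v, (∀ k, ⟪e k, v⟫_ℝ = 0) → ‖T v‖ ≤ ρ * ‖v‖) (a b : ℕ) (A : E →L[ℝ] E) :
    ∑ k, ∑ l, θ k ^ a * θ l ^ b * ⟪e k, A (e l)⟫_ℝ ^ 2 ≤ tr' (T ^ a * A * T ^ b * A†) := by
  have hdec : T ^ a * A * T ^ b * A† = framePow e θ a * (A * (T ^ b * A†)) + resid T e θ a * A * T ^ b * A† := by
    rw [pow_eq_framePow_add_resid (e := e) (θ := θ) a, add_mul, add_mul, add_mul, mul_assoc, mul_assoc]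
  rw [hdec, tr'_add, tr'_framePow_mul]
  have h2 : 0 ≤ tr' (resid T e θ a * A * T ^ b * A†) :=
    tr'_pos_mul_conj_nonneg (resid_isPositive hon hT hTe hρ hcon a) (isPositive_pow' hT b) A
  have h1 : ∀ k, θ k ^ a * ∑ l, θ l ^ b * ⟪e k, A (e l)⟫_ℝ ^ 2 ≤ θ k ^ a * ⟪e k, (A * (T ^ b * A†)) (e k)⟫_ℝ := by
    intro k
    refine mul_le_mul_of_nonneg_left ?_ (pow_nonneg (hθ k) a)
    have hu := frame_sq_le_inner_pow hon hT hTe hρ hcon b (A† (e k))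
    have heq : ∀ l, ⟪e l, A† (e k)⟫_ℝ = ⟪e k, A (e l)⟫_ℝ := fun l => by
      rw [ContinuousLinearMap.adjoint_inner_right, real_inner_comm]
    simp only [heq] at hu
    rw [mul_apply_eq_comp, mul_apply_eq_comp, ← ContinuousLinearMap.adjoint_inner_left]
    exact hu
  calc ∑ k, ∑ l, θ k ^ a * θ l ^ b * ⟪e k, A (e l)⟫_ℝ ^ 2
      = ∑ k, θ k ^ a * ∑ l, θ l ^ b * ⟪e k, A (e l)⟫_ℝ ^ 2 := by
        refine Finset.sum_congr rfl fun k _ => ?_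
        rw [Finset.mul_sum]
        refine Finset.sum_congr rfl fun l _ => ?_
        ring
    _ ≤ ∑ k, θ k ^ a * ⟪e k, (A * (T ^ b * A†)) (e k)⟫_ℝ := Finset.sum_le_sum fun k _ => h1 k
    _ ≤ _ := le_add_of_nonneg_right h2

/-! ## §2 Centring leaves `modelCorr` unchanged -/

omit [CompleteSpace E] [FiniteDimensional ℝ E] in
private theorem mul_smul_euc {d : ℕ} (c : ℝ) (A B : Euc d →L[ℝ] Euc d) : A * (c • B) = c • (A * B) := by
  ext v; simp

omit [CompleteSpace E] [FiniteDimensional ℝ E] in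
private theorem smul_mul_euc {d : ℕ} (c : ℝ) (A B : Euc d →L[ℝ] Euc d) : c • A * B = c • (A * B) := by
  ext v; simp

omit [CompleteSpace E] in
/-- Centring in the left slot by the «empty block» `T^w`: `modelCorr T (A − c·T^w) B = modelCorr T A B`. -/
theorem modelCorr_sub_smul_pow_left {d : ℕ} (T Ao Bo : Euc d →L[ℝ] Euc d) (S n w : ℕ) (c : ℝ) (hw : w ≤ n)
    (hn : n + w ≤ 2 * S + 1) (hZ : tr' (T ^ (2 * S + 1)) ≠ 0) :
    modelCorr T (Ao - c • T ^ w) Bo S n w = modelCorr T Ao Bo S n w := by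
  unfold modelCorr
  have e1 : T ^ (2 * S + 1 - n - w) * (Ao - c • T ^ w) * T ^ (n - w) * Bo =
      T ^ (2 * S + 1 - n - w) * Ao * T ^ (n - w) * Bo - c • (T ^ (2 * S + 1 - w) * Bo) := by
    have hp : T ^ (2 * S + 1 - n - w) * T ^ w * T ^ (n - w) = T ^ (2 * S + 1 - w) := by
      rw [← pow_add, ← pow_add]; congr 1; omega
    rw [mul_sub, sub_mul, sub_mul, mul_smul_euc, smul_mul_euc, smul_mul_euc, hp]
  have e2 : T ^ (2 * S + 1 - w) * (Ao - c • T ^ w) = T ^ (2 * S + 1 - w) * Ao - c • T ^ (2 * S + 1) := by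
    have hp : T ^ (2 * S + 1 - w) * T ^ w = T ^ (2 * S + 1) := by
      rw [← pow_add]; congr 1; omega
    rw [mul_sub, mul_smul_euc, hp]
  rw [e1, e2, tr'_sub, tr'_sub, tr'_smul, tr'_smul]
  field_simp
  ring

omit [CompleteSpace E] in
/-- Centring in the right slot: `modelCorr T A (B − c·T^w) = modelCorr T A B`. -/
theorem modelCorr_sub_smul_pow_right {d : ℕ} (T Ao Bo : Euc d →L[ℝ] Euc d) (S n w : ℕ) (c : ℝ) (hw : w ≤ n)
    (hn : n + w ≤ 2 * S + 1) (hZ : tr' (T ^ (2 * S + 1)) ≠ 0) :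
    modelCorr T Ao (Bo - c • T ^ w) S n w = modelCorr T Ao Bo S n w := by
  unfold modelCorr
  have e1 : tr' (T ^ (2 * S + 1 - n - w) * Ao * T ^ (n - w) * (Bo - c • T ^ w)) =
      tr' (T ^ (2 * S + 1 - n - w) * Ao * T ^ (n - w) * Bo) - c * tr' (T ^ (2 * S + 1 - w) * Ao) := by
    have hp : tr' (T ^ (2 * S + 1 - n - w) * Ao * T ^ (n - w) * T ^ w) = tr' (T ^ (2 * S + 1 - w) * Ao) := by
      rw [mul_assoc, ← pow_add, tr'_comm, ← mul_assoc, ← pow_add]; congr 3; omega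
    rw [mul_sub, mul_smul_euc, tr'_sub, tr'_smul, hp]
  have e2 : tr' (T ^ (2 * S + 1 - w) * (Bo - c • T ^ w)) = tr' (T ^ (2 * S + 1 - w) * Bo) - c * tr' (T ^ (2 * S + 1)) := by
    have hp : T ^ (2 * S + 1 - w) * T ^ w = T ^ (2 * S + 1) := by
      rw [← pow_add]; congr 1; omega
    rw [mul_sub, mul_smul_euc, hp, tr'_sub, tr'_smul]
  rw [e1, e2]
  field_simp
  ring

/-! ## §3 The antipodal mirror value controls the squared code defect -/

/-- **CODE inequality (model level).**  In an honest light-frame model on `ℝ^d` with `tr T^{2S+1} > 0` and block width `w ≤ S`,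
for every block observable `A` and `c := tr(T^{2S+1−w} A)/tr T^{2S+1}` (its model mean):
`Σ_{k,l} θ_k^{S+1−w} θ_l^{S−w} (⟨e_k, A e_l⟩ − c θ_k^w δ_{kl})² ≤ tr T^{2S+1} · modelCorr T A A† S S w` —
the θ-weighted squared Knill–Laflamme code defect of `A` is bounded by the antipodal mirror value. -/
theorem code_defect_sq_le_antipodal {d : ℕ} {T : Euc d →L[ℝ] Euc d} {e : Fin (q + 1) → Euc d} {θ : Fin (q + 1) → ℝ} {ρ : ℝ}
    (hon : Orthonormal ℝ e) (hT : T.IsPositive) (hTe : ∀ k, T (e k) = θ k • e k) (hθ : ∀ k, 0 ≤ θ k) (hρ : 0 ≤ ρ)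
    (hcon : ∀ v, (∀ k, ⟪e k, v⟫_ℝ = 0) → ‖T v‖ ≤ ρ * ‖v‖) (S w : ℕ) (hw : w ≤ S) (hZ : 0 < tr' (T ^ (2 * S + 1)))
    (Ao : Euc d →L[ℝ] Euc d) :
    ∑ k, ∑ l, θ k ^ (S + 1 - w) * θ l ^ (S - w) *
        (⟪e k, Ao (e l)⟫_ℝ - if k = l then tr' (T ^ (2 * S + 1 - w) * Ao) / tr' (T ^ (2 * S + 1)) * θ k ^ w else 0) ^ 2
      ≤ tr' (T ^ (2 * S + 1)) * modelCorr T Ao (Ao†) S S w := by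
  set Z := tr' (T ^ (2 * S + 1)) with hZdef
  set c := tr' (T ^ (2 * S + 1 - w) * Ao) / Z with hcdef
  set Ac := Ao - c • T ^ w with hAc
  have hZ0 : Z ≠ 0 := hZ.ne'
  -- centring in both slots
  have hTw : (T ^ w)† = T ^ w := (isPositive_pow' hT w).isSelfAdjoint.adjoint_eq
  have hAc_adj : Ac† = Ao† - c • T ^ w := by
    rw [hAc, map_sub, map_smulₛₗ, hTw, starRingEnd_apply, star_trivial]
  have hcorr : modelCorr T Ao (Ao†) S S w = modelCorr T Ac (Ac†) S S w := by
    rw [hAc_adj, modelCorr_sub_smul_pow_right T Ac (Ao†) S S w c hw (by omega) hZ0, hAc,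
      modelCorr_sub_smul_pow_left T Ao (Ao†) S S w c hw (by omega) hZ0]
  -- the centred observable has model mean zero
  have hmean : tr' (T ^ (2 * S + 1 - w) * Ac) = 0 := by
    have hp : T ^ (2 * S + 1 - w) * T ^ w = T ^ (2 * S + 1) := by
      rw [← pow_add]; congr 1; omega
    rw [hAc, mul_sub, mul_smul_euc, hp, tr'_sub, tr'_smul, hcdef, ← hZdef]
    field_simp; ring
  have hexp : 2 * S + 1 - S - w = S + 1 - w := by omega
  have hval : modelCorr T Ac (Ac†) S S w = tr' (T ^ (S + 1 - w) * Ac * T ^ (S - w) * Ac†) / Z := by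
    unfold modelCorr
    rw [hmean, ← hZdef, zero_div, zero_mul, sub_zero, hexp]
  -- frame entries of the centred observable
  have hentry : ∀ k l, ⟪e k, Ac (e l)⟫_ℝ =
      ⟪e k, Ao (e l)⟫_ℝ - if k = l then c * θ k ^ w else 0 := by
    intro k l
    rw [hAc, sub_apply, smul_apply, pow_apply_frame hTe w l, inner_sub_right,
      real_inner_smul_right, real_inner_smul_right, orthonormal_iff_ite.mp hon k l]
    by_cases h : k = l
    · subst h; simp
    · simp [h]
  have hmain := frame_sq_le_tr hon hT hTe hθ hρ hcon (S + 1 - w) (S - w) Ac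
  simp only [hentry] at hmain
  rw [hcorr, hval, mul_div_cancel₀ _ hZ0]
  exact hmain

end Summit.QuantumFields.YangMills.Cruxes.IR.AntipodalCode
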